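import Literature.AlgebraicGeometry.Motives.FormsEmbedding
import Summits.ResolutionOfSingularities.ResolutionOfSingularities.Theorems.EquisingularLiftEquisingularLiftFormsEmbeddingIndex
import Summits.ResolutionOfSingularities.ResolutionOfSingularities.Theorems.EquisingularLiftEquisingularLiftSerreGenerators
import HarnessLib

/-!
# Crux `EquisingularLift`, stub `stub_linearCentre_of_blowupModel` (skeleton v10b): the RE-EMBEDDING (pieces (A)+(B))

[OURS · L1 W4.5b] Helper for the registered stub `stub_linearCentre_of_blowupModel` of the crux `EquisingularLift`
(stmt-ResolutionOfSingularities-15660); NOT a statement of any manuscript. AI-produced, weaker than expert review.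

**RE-EMBEDDING.** For a field `k`, a closed immersion `ι : H → ℙⁿ_k` and an ideal sheaf `𝔞` on `H` there are
`r m : ℕ`, a closed immersion `j : H → ℙ^{r+m}_k` and a set `S` of homogeneous coordinates of `ℙ^{r+m}_k` such that
the charts `j⁻¹D₊(y_c)`, `c ∈ S`, are affine and cover `H`, and on each of them the ideal of `𝔞` is generated by the
pulled-back coordinate ratios `j^*(y_a/y_c)` with `r + 1 ≤ a` — i.e. by the equations of the coordinate linear
subspace `Λ = V(y_{r+1}, …, y_{r+m})` (the hypothesis `hre` of `LinearCentre.linearCentre_of_blowupModel_of_reembedding`,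
stub worker 1). Proof = (A) Serre generators (`serreGen_exists_forms_projectiveSpace`, stub worker 3: forms `V_l` of one
degree `d ≥ 1` with `𝔞(ι⁻¹D₊(x_i)) = (ι^*(V_l/x_i^d))_l`) + (B) the re-embedding by the forms
`x_i^{2d}, x_{i'} x_i^{2d-1}, x_i^d V_l` (`Literature.AlgebraicGeometry.Motives.GeneratingSections.formsMap`,
`isClosedImmersion_formsMap`, `homRatio_formsMap_of_eq_inr`) with the labelling of `exists_formsIndex_equiv`
putting the `x_i^d V_l` last; `S` = the coordinates `x_i^{2d}`, whose charts are the `ι⁻¹D₊(x_i)`.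
This discharges `hre`; the registered stub itself was landed independently by the lead through
`GeneratingSections.famData` (`…LinearCentreOfBlowupModel`), so this file is the explicit-forms variant of the
re-embedding (the `V`-coordinates are forms of ONE degree `d` on `ℙⁿ_k`).
-/

set_option linter.dupNamespace false -- mandated namespace `Summit.<Summit>.<Problem>` of this single-conjunct summit

noncomputable section

open CategoryTheory AlgebraicGeometry TopologicalSpace Opposite HomogeneousLocalization
open Literature.AlgebraicGeometry.Motives Literature.AlgebraicGeometry.Motives.Segre
open Literature.AlgebraicGeometry.Motives.GeneratingSections

attribute [local instance] MvPolynomial.gradedAlgebra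

universe u

namespace Summit.ResolutionOfSingularities.ResolutionOfSingularities.Cruxes.EquisingularLift.StrataSplit

/-- Transport of the chart ideals of an ideal sheaf along an EQUALITY of affine opens: restriction along `U = U'`
is an identification under which `𝔞(U)` corresponds to `𝔞(U')`. [folklore] -/
theorem ideal_eq_map_rs_of_eq {Y : Scheme.{u}} (𝔞 : Y.IdealSheafData) {U U' : Y.Opens} (h : U = U')
    (hU : IsAffineOpen U) (hU' : IsAffineOpen U') :
    𝔞.ideal ⟨U, hU⟩ = (𝔞.ideal ⟨U', hU'⟩).map (rs h.le) := by
  subst h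
  apply le_antisymm
  · intro x hx
    have hx' := Ideal.mem_map_of_mem (rs (le_refl U)) hx
    rwa [rs_refl] at hx'
  · rw [Ideal.map_le_iff_le_comap]
    intro x hx
    rw [Ideal.mem_comap, rs_refl]
    exact hx

/-- **RE-EMBEDDING** (pieces (A)+(B) of `stub_linearCentre_of_blowupModel`; the hypothesis `hre` of
`LinearCentre.linearCentre_of_blowupModel_of_reembedding`): every closed subscheme `H` of `ℙⁿ_k` with an ideal sheaf
`𝔞` re-embeds as a closed subscheme `j : H → ℙ^{r+m}_k` such that, on a covering family of affine coordinate charts,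
`𝔞` is generated by the pulled-back coordinate ratios `j^*(y_a/y_c)`, `r + 1 ≤ a`. (`IsIntegral H` is not used.)
[OURS · L1 W4.5b] -/
theorem reembedding (k : Type u) [Field k] (n : ℕ) (H : Scheme.{u})
    (ι : H ⟶ (Literature.AlgebraicGeometry.Motives.projectiveSpace n k).left) (hι : IsClosedImmersion ι)
    (_hH : IsIntegral H) (𝔞 : H.IdealSheafData) :
    ∃ (r m : ℕ) (j : H ⟶ Proj (MvPolynomial.homogeneousSubmodule (Fin (r + m + 1)) k))
      (S : Set (Fin (r + m + 1)))
      (hV : ∀ i ∈ S, IsAffineOpen (j ⁻¹ᵁ Proj.basicOpen (MvPolynomial.homogeneousSubmodule (Fin (r + m + 1)) k)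
        (MvPolynomial.X i))),
      IsClosedImmersion j ∧
      (⨆ i : S, j ⁻¹ᵁ Proj.basicOpen (MvPolynomial.homogeneousSubmodule (Fin (r + m + 1)) k)
        (MvPolynomial.X (i : Fin (r + m + 1)))) = ⊤ ∧
      ∀ (i : Fin (r + m + 1)) (hi : i ∈ S),
        𝔞.ideal ⟨j ⁻¹ᵁ Proj.basicOpen (MvPolynomial.homogeneousSubmodule (Fin (r + m + 1)) k)
          (MvPolynomial.X i), hV i hi⟩ =
          Ideal.span (Set.range fun a : {a : Fin (r + m + 1) // r + 1 ≤ (a : ℕ)} =>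
            GeneratingSections.homRatio j i a.1) := by
  haveI : @IsClosedImmersion H (Proj (grading (Fin (n + 1)) k)) ι := hι
  -- (A) Serre generators: forms `V_l` of one degree `d ≥ 1` generating `𝔞` chart by chart
  obtain ⟨d, m', V, hd, -, hA⟩ := serreGen_exists_forms_projectiveSpace n k H ι hι 𝔞
  -- (B') the labelling of the coordinates of the re-embedding, `x_i^d V_l` last
  obtain ⟨r, m, e, he⟩ := exists_formsIndex_equiv n m'
  -- (B) the re-embedding by the forms `x_i^{2d}, x_{i'} x_i^{2d-1}, x_i^d V_l`
  set f : H ⟶ Spec (.of k) := ι ≫ toSpec (Fin (n + 1)) k with hf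
  have hVh : ∀ l, (fun l ↦ ((V l : ↥(MvPolynomial.homogeneousSubmodule (Fin (n + 1)) k d)) :
      MvPolynomial (Fin (n + 1)) k)) l |>.IsHomogeneous d := fun l ↦ (V l).2
  set j : H ⟶ Proj (grading (Fin (r + m + 1)) k) :=
    formsMap f ι hd (fun l ↦ ((V l : ↥(MvPolynomial.homogeneousSubmodule (Fin (n + 1)) k d)) :
      MvPolynomial (Fin (n + 1)) k)) hVh e with hj
  -- the home charts: the coordinates `x_i^{2d}`
  set S : Set (Fin (r + m + 1)) := Set.range fun i : Fin (n + 1) ↦ e.symm (i, Sum.inl none) with hS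
  have hbase : ∀ i : Fin (n + 1), e (e.symm (i, Sum.inl none)) = (i, Sum.inl none) := fun i ↦
    e.apply_symm_apply _
  have hpre : ∀ i : Fin (n + 1),
      j ⁻¹ᵁ Proj.basicOpen (grading (Fin (r + m + 1)) k) (MvPolynomial.X (e.symm (i, Sum.inl none))) =
        ι ⁻¹ᵁ Proj.basicOpen (grading (Fin (n + 1)) k) (MvPolynomial.X i) := fun i ↦
    formsMap_preimage_basicOpen_of_eq_none f ι hd _ hVh e (hbase i)
  have hVaff : ∀ c ∈ S, IsAffineOpen (j ⁻¹ᵁ Proj.basicOpen (grading (Fin (r + m + 1)) k) (MvPolynomial.X c)) := by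
    rintro _ ⟨i, rfl⟩
    rw [hpre i]
    exact isAffineOpen_ofHom_U ι i
  refine ⟨r, m, j, S, hVaff, ?_, ?_, ?_⟩
  · -- closed immersion
    exact isClosedImmersion_formsMap f ι hd _ hVh e rfl
  · -- the home charts cover `H`
    rw [← top_le_iff, ← iSup_preimage_basicOpen_none f ι hd _ hVh e, iSup_le_iff]
    intro i
    exact le_iSup (fun c : S ↦ j ⁻¹ᵁ Proj.basicOpen (grading (Fin (r + m + 1)) k)
      (MvPolynomial.X (c : Fin (r + m + 1)))) ⟨e.symm (i, Sum.inl none), i, rfl⟩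
  · -- the chart ideals
    rintro _ ⟨i, rfl⟩
    have hW : j ⁻¹ᵁ Proj.basicOpen (grading (Fin (r + m + 1)) k) (MvPolynomial.X (e.symm (i, Sum.inl none))) ≤
        (ofHom ι).U i := (hpre i).le
    rw [ideal_eq_map_rs_of_eq 𝔞 (hpre i) (hVaff _ ⟨i, rfl⟩) (isAffineOpen_ofHom_U ι i), hA i, Ideal.map_span,
      ← Set.range_comp]
    apply le_antisymm
    · -- the generators `ι^*(V_l/x_i^d)` are the ratios `y_{(i, inr l)}/y_{(i, inl none)}`
      apply Ideal.span_le.mpr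
      rintro _ ⟨l, rfl⟩
      have hb : e (e.symm (i, Sum.inr l)) = (i, Sum.inr l) := e.apply_symm_apply _
      have hle : r + 1 ≤ ((e.symm (i, Sum.inr l) : Fin (r + m + 1)) : ℕ) := (he _).2 ⟨i, l, hb⟩
      refine Ideal.subset_span ⟨⟨e.symm (i, Sum.inr l), hle⟩, ?_⟩
      rw [Function.comp_apply]
      exact homRatio_formsMap_of_eq_inr_self_eq_app f ι hd _ hVh e rfl (hbase i) hb hW
    · -- every killed ratio `y_{(i'', inr l)}/y_{(i, inl none)} = ι^*(V_l/x_i^d) · ι^*(x_{i''}/x_i)^d` lies in `𝔞`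
      apply Ideal.span_le.mpr
      rintro _ ⟨⟨c, hc⟩, rfl⟩
      obtain ⟨i'', l, hcl⟩ := (he c).1 hc
      have h1 : homRatio j (e.symm (i, Sum.inl none)) c =
          rs hW ((ofHom ι).sectionsFun f i (V l : MvPolynomial (Fin (n + 1)) k) * (ofHom ι).ratio i i'' ^ d) :=
        homRatio_formsMap_of_eq_inr f ι hd _ hVh e (hbase i) hcl hW
      show homRatio j (e.symm (i, Sum.inl none)) c ∈ _
      rw [h1, map_mul]
      refine Ideal.mul_mem_right _ _ (Ideal.subset_span ⟨l, ?_⟩)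
      exact (congrArg (rs hW) (sectionsFun_ofHom_eq_app f ι rfl i _ (V l).2)).symm


end Summit.ResolutionOfSingularities.ResolutionOfSingularities.Cruxes.EquisingularLift.StrataSplit
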